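import Literature.Computability.QuantumComplexity.CoreDescUniform
import Literature.Computability.QuantumComplexity.JonesDigestFP
import HarnessLib

/-!
# The plat-closure Jones polynomial at `e^{2πi/5}` is in `PromiseBQP`: discharge

Topic `Literature/Computability/QuantumComplexity`; the discharge (D-0014) of the named fact
`ajl_jonesApproxProblem_mem_PromiseBQP` of `JonesInBQP.lean` — Aharonov–Jones–Landau, *A polynomial
quantum algorithm for approximating the Jones polynomial*, Algorithmica 55 (2009) 395–421
(= arXiv:quant-ph/0511096), Thm. 1.2 (plat closure) with §3 (Algorithm
Approximate-Jones-Plat-Closure, Claim 3.3, Thm. 3.2), in the threshold form of Aharonov–Arad (New J.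
Phys. 13 (2011), §1) at `k = 5`. The proof assembled in the tree: the path-model representation and
its matrix elements (`PathModel*.lean`, `JonesLoopCount.lean`), the exact Clifford+T core circuit
family with dyadic block encodings of the golden-ratio rotations and one round of oblivious amplitude
amplification (`ApproxImplementation.lean` … `CoreSolvable.lean`: success probability `≥ 2/3` on
well-formed digests), the classical digest and post-processor in `FP` (`JonesDigestFP.lean`,
`JonesPostFP.lean`, strand compression `StrandCompress*.lean`), and the polynomial-time uniformity of
the core family (`CoreDesc*.lean`, `AJLCore.family_isUniform`). As a corollary the conditional
`ajl_mem_PromiseBQPOver_ajlGateSet_of_uniform` (`JonesDigestFP.lean`) discharges the older named fact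
`ajl_mem_PromiseBQPOver_ajlGateSet` (`JonesInBQPProofs.lean`, AJL in its own gate set).

## References

* D. Aharonov, V. Jones, Z. Landau, Algorithmica 55 (2009) 395–421, Thm. 1.2, §3.3, Claim 3.3
  [AharonovJonesLandau2009].
* D. Aharonov, I. Arad, New J. Phys. 13 (2011), §1 [AharonovArad2011].
-/

namespace Literature.Computability.QuantumComplexity

/-- **Aharonov–Jones–Landau (2009), Thm. 1.2 at `k = 5` (decision form): the Jones approximation
problem is in `PromiseBQP`.** Discharge of `ajl_jonesApproxProblem_mem_PromiseBQP`.
[cite: AharonovJonesLandau2009, Thm. 1.2 and §3.3] [cite: AharonovArad2011, §1 (normalisation)] -/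
theorem ajl_jonesApproxProblem_mem_PromiseBQP_holds : ajl_jonesApproxProblem_mem_PromiseBQP :=
  AJLCore.mem_PromiseBQP_of_uniform AJLCore.family_isUniform

/-- **AJL in AJL's own gate set** (discharge of `ajl_mem_PromiseBQPOver_ajlGateSet`).
[cite: AharonovJonesLandau2009, Thm. 1.2 and §3.3] -/
theorem ajl_mem_PromiseBQPOver_ajlGateSet_holds : ajl_mem_PromiseBQPOver_ajlGateSet :=
  ajl_mem_PromiseBQPOver_ajlGateSet_of_uniform AJLCore.family_isUniform

end Literature.Computability.QuantumComplexity
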